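import Summits.ResolutionOfSingularities.ResolutionOfSingularities.Theorems.FrobeniusClosingSteerPlaneBezoutInequality
import Literature.AlgebraicGeometry.Resolution.AffineDomainEquidim
import Mathlib.RingTheory.Ideal.KrullsHeightTheorem
import Mathlib.RingTheory.Finiteness.Nakayama
import Mathlib.RingTheory.Jacobson.Ring
import Mathlib.Algebra.MvPolynomial.Nilpotent
import HarnessLib

/-!
# Steer / CLAIM R kernel, file R2: A MINIMAL-DEGREE ELEMENT OF A MAXIMAL IDEAL OF `K[y,z]` IS A REGULAR PARAMETER,
# and its degree `δ` satisfies `δ(δ+1) ≤ 2 [κ(𝔪) : K]`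

OURS (campaign res-hironaka, rung L ★L-G4, slot W4.1, crux `Steer` stmt-ResolutionOfSingularities-16345; res-L0-w41-plan-1 RULING 160d
«CLAIM R kernel → first free kernel hands» / 171c; res-L0-w41-idea-3 g9; consumer: CLAIM R = (K-H) `LemmaI.GeomSupplyRegularCurve`;
replaces the role of no printed item; NOT a statement of the manuscript under review [claim: Hironaka2017, status: under-review]; AI review
is weaker than expert review). Theses-free, definition-free, commutative algebra over an ARBITRARY field `K` (finite, imperfect, … allowed).

THE STATEMENT (`exists_mem_notMem_sq`). Let `𝔪 ⊂ A = K[X₀,X₁]` be a maximal ideal with residue degree `q = dim_K A⧸𝔪` and let `δ` be the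
least total degree of a non-zero element of `𝔪`. Then `δ(δ+1) ≤ 2q`, and every `f ∈ 𝔪` of degree `δ` is irreducible and lies OUTSIDE `𝔪²` —
i.e. the minimal-degree curve through the closed point `P ↔ 𝔪` is regular at `P` (`A_𝔪⧸(f)` is a regular local ring of dimension one).
Geometrically (CLAIM R of the Steer cell): in the exceptional plane `E ≅ ℙ²_κ` of a point blow-up, through a NON-rational near point `P`
of residue degree `q ≥ 2` there is a curve of degree `δ` with `δ(δ+1) ≤ 2q` which is regular at `P`; file R3 translates this chart statement
into the local-ring language of (K-H).

MECHANISM (no Bézout theorem in length form, no algebraic closure, no `κ` infinite):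
* §1 `not_le_sq_sup_span_singleton` — Nakayama + Krull's principal ideal theorem: a prime `𝔪` of height `≥ 2` in a Noetherian ring is
  not contained in `𝔪² + (g)` for any `g ∈ 𝔪` (else `𝔪⧸(g)` is killed by some `r ≡ 1 (mod 𝔪)`, so `𝔪` is minimal over `(g)`, height `≤ 1`);
* §2 `two_mul_finrank_le_finrank_quotient` — hence `dim_K A⧸(𝔪² + (g)) ≥ 2q` (rank–nullity for `A⧸J ↠ A⧸𝔪` and for `· m̄` on `A⧸J`);
* §3 `finrank_restrictTotalDegree_le_add` — `dim V_e ≤ q + dim (V_e ∩ 𝔪)` for the degree filtration `V_e = A_{≤ e}` (rank–nullity of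
  `V_e → A⧸𝔪`); so `V_{δ-1} ∩ 𝔪 = 0` gives `C(δ+1, 2) ≤ q`, and `V_e ∩ 𝔪` contains a non-multiple of `f` as soon as
  `C(e+2,2) > q + C(e+2-δ, 2)` (tree `finrank_restrictTotalDegree_inf_span_le`);
* §4 `irreducible_of_degree_minimal` — a minimal-degree element of a prime is irreducible (a factor in `𝔪` would have smaller degree);
* §5 the assembly: if `f ∈ 𝔪²`, take `e = ⌊(2q-1)/δ⌋` (so `δe < 2q ≤ δ(e+1)`, whence `e ≥ δ` and the room inequality), pick `g ∈ V_e ∩ 𝔪`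
  with `f ∤ g`; `f` irreducible gives `IsRelPrime f g`, and the plane Bézout inequality of file R1 (`finrank_quotient_span_pair_le`) yields
  `2q ≤ dim_K A⧸(𝔪² + (g)) ≤ dim_K A⧸(f, g) ≤ δ e < 2q` — contradiction. Height two of `𝔪` is the tree's `MvPolynomial.height_eq_of_isMaximal`
  (`AffineDomainEquidim.lean`); finiteness of `A⧸𝔪` over `K` is Zariski's lemma (Mathlib `finite_of_finite_type_of_isJacobsonRing`).
[cite: Kunz2005PlaneAlgebraicCurves, App. A Lemma A.11] [cite: Matsumura1987, Thm. 13.5 (Krull), §14] [folklore]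
-/

noncomputable section

-- single-problem summit: the doubled namespace component `ResolutionOfSingularities` is forced
set_option linter.dupNamespace false

namespace Summit.ResolutionOfSingularities.ResolutionOfSingularities.Theorems.SwitchingDichotomy.ClaimR

open MvPolynomial Module
open Literature.NumberTheory.DiophantineGeometry.PlaneCurve
  (finrank_restrictTotalDegree_fin_two finite_restrictTotalDegree finrank_restrictTotalDegree_inf_span_le)

/-! ## §1 Nakayama + Krull: a prime of height `≥ 2` is not inside `𝔪² + (g)` -/

/-- **A prime of height `≥ 2` is not contained in `𝔪² + (g)`** (`g ∈ 𝔪`), in a Noetherian ring: otherwise Nakayama applied to the image of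
`𝔪` in `R⧸(g)` produces `r ≡ 1 (mod 𝔪)` with `r𝔪 ⊆ (g)`, so `𝔪` is a minimal prime of `(g)` and Krull's principal ideal theorem bounds its
height by one. [cite: Matsumura1987, Thm. 13.5, Thm. 2.2 (Nakayama)] [folklore] -/
theorem not_le_sq_sup_span_singleton {R : Type*} [CommRing R] [IsNoetherianRing R] (𝔪 : Ideal R) [h𝔪 : 𝔪.IsPrime]
    (h2 : ¬ 𝔪.height ≤ 1) {g : R} (hg : g ∈ 𝔪) : ¬ 𝔪 ≤ 𝔪 ^ 2 ⊔ Ideal.span {g} := by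
  intro hle
  -- Nakayama for `N = 𝔪 (R ⧸ (g))`: `N ≤ 𝔪 • N`
  let N : Submodule R (R ⧸ Ideal.span {g}) := Submodule.map (Ideal.span {g}).mkQ 𝔪
  have hNfg : N.FG := (IsNoetherian.noetherian 𝔪).map _
  have hNle : N ≤ 𝔪 • N := by
    rintro x ⟨m, hm, rfl⟩
    obtain ⟨y, hy, z, hz, hyz⟩ := Submodule.mem_sup.1 (hle hm)
    have hz0 : (Ideal.span {g}).mkQ z = 0 := by
      rw [Submodule.mkQ_apply, Submodule.Quotient.mk_eq_zero]; exact hz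
    have hmy : (Ideal.span {g}).mkQ m = (Ideal.span {g}).mkQ y := by
      rw [← hyz, map_add, hz0, add_zero]
    rw [hmy]
    rw [pow_two] at hy
    refine Submodule.mul_induction_on hy (fun a ha b hb => ?_) (fun a b ha hb => ?_)
    · rw [← smul_eq_mul, map_smul]
      exact Submodule.smul_mem_smul ha (Submodule.mem_map_of_mem hb)
    · rw [map_add]; exact add_mem ha hb
  obtain ⟨r, hr1, hrN⟩ := Submodule.exists_sub_one_mem_and_smul_eq_zero_of_fg_of_le_smul 𝔪 N hNfg hNle
  -- hence `r 𝔪 ⊆ (g)` with `r ∉ 𝔪`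
  have hrm : ∀ m ∈ 𝔪, r * m ∈ Ideal.span {g} := by
    intro m hm
    have h := hrN _ (Submodule.mem_map_of_mem (f := (Ideal.span {g}).mkQ) hm)
    rwa [Submodule.mkQ_apply, ← Submodule.Quotient.mk_smul, Submodule.Quotient.mk_eq_zero, smul_eq_mul] at h
  have hr : r ∉ 𝔪 := by
    intro h
    apply h𝔪.ne_top
    rw [Ideal.eq_top_iff_one]
    have : r - (r - 1) ∈ 𝔪 := sub_mem h hr1
    rwa [sub_sub_cancel] at this
  -- so `𝔪` is a minimal prime of `(g)`, of height `≤ 1`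
  have hmin : 𝔪 ∈ (Ideal.span {g}).minimalPrimes := by
    refine ⟨⟨h𝔪, (Ideal.span_singleton_le_iff_mem _).2 hg⟩, ?_⟩
    rintro P ⟨hP, hgP⟩ hP𝔪 m hm
    exact (hP.mem_or_mem (hgP (hrm m hm))).resolve_left fun hrP => hr (hP𝔪 hrP)
  exact h2 (Ideal.height_le_one_of_isPrincipal_of_mem_minimalPrimes (Ideal.span {g}) 𝔪 hmin)

/-! ## §2 The residue-degree count: `dim_K A⧸J ≥ 2 dim_K A⧸𝔪` when `𝔪² ≤ J ≤ 𝔪` and `𝔪 ⊄ J` -/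

section Count

variable {K : Type*} [Field K] {A : Type*} [CommRing A] [Algebra K A]

/-- **Two residue copies.** If `𝔪` is maximal, `𝔪·𝔪 ≤ J ≤ 𝔪` and some `m ∈ 𝔪` is not in `J`, then `dim_K A⧸J ≥ 2 · dim_K A⧸𝔪`: by
rank–nullity for the projection `π : A⧸J ↠ A⧸𝔪` it suffices that `dim ker π ≥ dim A⧸𝔪`, and multiplication by `m̄` on `A⧸J` has range
inside `ker π` and kernel inside `ker π` (if `a m ∈ J` then `a ∈ 𝔪`, as `a` invertible mod `𝔪` would put `m` in `J`), so rank–nullity for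
it gives `dim A⧸J = dim range (·m̄) + dim ker (·m̄) ≤ 2 dim ker π`, while `dim A⧸J = dim A⧸𝔪 + dim ker π`. [folklore] -/
theorem two_mul_finrank_le_finrank_quotient (𝔪 J : Ideal A) [h𝔪 : 𝔪.IsMaximal] (hJ : J ≤ 𝔪) (hJ2 : 𝔪 * 𝔪 ≤ J)
    {m : A} (hm : m ∈ 𝔪) (hmJ : m ∉ J) [Module.Finite K (A ⧸ J)] :
    2 * finrank K (A ⧸ 𝔪) ≤ finrank K (A ⧸ J) := by
  let π : (A ⧸ J) →ₐ[K] (A ⧸ 𝔪) := Ideal.Quotient.factorₐ K hJ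
  have hπs : Function.Surjective π := Ideal.Quotient.factor_surjective hJ
  let πK : (A ⧸ J) →ₗ[K] (A ⧸ 𝔪) := π.toLinearMap
  have hπK : ∀ x, πK x = π x := fun _ => rfl
  have hπmk : ∀ a : A, π (Ideal.Quotient.mk J a) = Ideal.Quotient.mk 𝔪 a := fun _ => rfl
  let μ : (A ⧸ J) →ₗ[K] (A ⧸ J) := LinearMap.mulRight K (Ideal.Quotient.mk J m)
  have hμ : ∀ x, μ x = x * Ideal.Quotient.mk J m := fun _ => rfl
  -- `range μ ≤ ker π`
  have h1 : LinearMap.range μ ≤ LinearMap.ker πK := by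
    rintro x ⟨y, rfl⟩
    obtain ⟨a, rfl⟩ := Ideal.Quotient.mk_surjective y
    rw [LinearMap.mem_ker, hπK, hμ, ← map_mul, hπmk, Ideal.Quotient.eq_zero_iff_mem]
    exact 𝔪.mul_mem_left a hm
  -- `ker μ ≤ ker π`
  have h2 : LinearMap.ker μ ≤ LinearMap.ker πK := by
    intro x hx
    obtain ⟨a, rfl⟩ := Ideal.Quotient.mk_surjective x
    rw [LinearMap.mem_ker, hμ, ← map_mul, Ideal.Quotient.eq_zero_iff_mem] at hx
    rw [LinearMap.mem_ker, hπK, hπmk, Ideal.Quotient.eq_zero_iff_mem]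
    by_contra ha
    obtain ⟨b, i, hi, hbi⟩ := h𝔪.exists_inv ha
    apply hmJ
    have hm' : m = b * (a * m) + i * m := by
      rw [← mul_assoc, ← add_mul, hbi, one_mul]
    rw [hm']
    exact J.add_mem (J.mul_mem_left b hx) (hJ2 (Ideal.mul_mem_mul hi hm))
  have hrnπ := LinearMap.finrank_range_add_finrank_ker πK
  have hrnμ := LinearMap.finrank_range_add_finrank_ker μ
  have hrange : finrank K (LinearMap.range πK) = finrank K (A ⧸ 𝔪) := by
    rw [LinearMap.range_eq_top.2 (fun y => hπs y), finrank_top]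
  have h1' := Submodule.finrank_mono h1
  have h2' := Submodule.finrank_mono h2
  omega

end Count

/-! ## §3 The degree filtration against a maximal ideal of `K[X₀,X₁]` -/

variable {K : Type*} [Field K]

/-- **`dim V_e ≤ dim_K A⧸𝔪 + dim (V_e ∩ 𝔪)`** (rank–nullity for `V_e → A⧸𝔪`, whose kernel is `V_e ∩ 𝔪`). [folklore] -/
theorem finrank_restrictTotalDegree_le_add (𝔪 : Ideal (MvPolynomial (Fin 2) K))
    [Module.Finite K (MvPolynomial (Fin 2) K ⧸ 𝔪)] (e : ℕ) :
    finrank K ↥(restrictTotalDegree (Fin 2) K e) ≤ finrank K (MvPolynomial (Fin 2) K ⧸ 𝔪) +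
      finrank K ↥(restrictTotalDegree (Fin 2) K e ⊓ 𝔪.restrictScalars K) := by
  haveI := finite_restrictTotalDegree K (Fin 2) e
  let ρ : ↥(restrictTotalDegree (Fin 2) K e) →ₗ[K] MvPolynomial (Fin 2) K ⧸ 𝔪 :=
    (Ideal.Quotient.mkₐ K 𝔪).toLinearMap ∘ₗ (restrictTotalDegree (Fin 2) K e).subtype
  have hρ : ∀ x, ρ x = Ideal.Quotient.mk 𝔪 (x : MvPolynomial (Fin 2) K) := fun _ => rfl
  have hker : LinearMap.ker ρ = Submodule.comap (restrictTotalDegree (Fin 2) K e).subtype (𝔪.restrictScalars K) := by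
    ext x
    rw [LinearMap.mem_ker, Submodule.mem_comap, Submodule.restrictScalars_mem, hρ, Submodule.subtype_apply]
    exact Ideal.Quotient.eq_zero_iff_mem
  have h1 := LinearMap.finrank_range_add_finrank_ker ρ
  have h2 : finrank K (LinearMap.range ρ) ≤ finrank K (MvPolynomial (Fin 2) K ⧸ 𝔪) := Submodule.finrank_le _
  have h3 : finrank K (LinearMap.ker ρ) = finrank K ↥(restrictTotalDegree (Fin 2) K e ⊓ 𝔪.restrictScalars K) := by
    rw [hker, ← Submodule.finrank_map_subtype_eq, Submodule.map_comap_subtype]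
  omega

/-- **Room ⇒ a non-multiple**: if `C(e+2,2) > dim_K A⧸𝔪 + C(e+2-deg f, 2)` then some `g ∈ 𝔪` of degree `≤ e` is not a multiple of `f`.
[folklore] -/
theorem exists_mem_notMem_span_of_lt (𝔪 : Ideal (MvPolynomial (Fin 2) K)) [Module.Finite K (MvPolynomial (Fin 2) K ⧸ 𝔪)]
    {f : MvPolynomial (Fin 2) K} (hf : f ≠ 0) {e : ℕ}
    (hroom : finrank K (MvPolynomial (Fin 2) K ⧸ 𝔪) + (e + 2 - f.totalDegree).choose 2 < (e + 2).choose 2) :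
    ∃ g : MvPolynomial (Fin 2) K, g ∈ 𝔪 ∧ g.totalDegree ≤ e ∧ ¬ f ∣ g := by
  haveI := finite_restrictTotalDegree K (Fin 2) e
  set W := restrictTotalDegree (Fin 2) K e ⊓ 𝔪.restrictScalars K with hW
  set F := restrictTotalDegree (Fin 2) K e ⊓ (Ideal.span {f}).restrictScalars K with hF
  haveI : Module.Finite K ↥F := Submodule.finiteDimensional_of_le (inf_le_left : F ≤ _)
  have hcount := finrank_restrictTotalDegree_le_add 𝔪 e
  rw [finrank_restrictTotalDegree_fin_two K e] at hcount
  have hFle := finrank_restrictTotalDegree_inf_span_le hf e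
  have hlt : finrank K ↥F < finrank K ↥W := by rw [hF, hW]; omega
  have hWF : ¬ W ≤ F := fun hle => absurd (Submodule.finrank_mono hle) (not_le.2 hlt)
  obtain ⟨g, hgW, hgF⟩ := Set.not_subset.1 hWF
  rw [hW, SetLike.mem_coe, Submodule.mem_inf, mem_restrictTotalDegree, Submodule.restrictScalars_mem] at hgW
  refine ⟨g, hgW.2, hgW.1, fun hfg => hgF ?_⟩
  rw [hF, SetLike.mem_coe, Submodule.mem_inf, mem_restrictTotalDegree, Submodule.restrictScalars_mem]
  exact ⟨hgW.1, Ideal.mem_span_singleton.2 hfg⟩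

/-! ## §4 Minimal degree ⇒ irreducible -/

/-- A non-zero constant of `K[X₀,X₁]` is a unit; so an element of a proper ideal has positive degree. [folklore] -/
theorem totalDegree_pos_of_mem {𝔪 : Ideal (MvPolynomial (Fin 2) K)} (h𝔪 : 𝔪 ≠ ⊤) {f : MvPolynomial (Fin 2) K}
    (hf0 : f ≠ 0) (hf : f ∈ 𝔪) : 0 < f.totalDegree := by
  rw [Nat.pos_iff_ne_zero]
  intro hdeg
  apply h𝔪
  apply Ideal.eq_top_of_isUnit_mem 𝔪 hf
  rw [isUnit_iff_totalDegree_of_isReduced]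
  refine ⟨isUnit_iff_ne_zero.2 fun hc => hf0 ?_, hdeg⟩
  rw [totalDegree_eq_zero_iff_eq_C.1 hdeg, hc, C_0]

/-- **A minimal-degree element of a prime is irreducible**: a factorisation `f = a b` puts a factor in the prime `𝔪`; if the other factor is
not a unit it has positive degree, so the first has smaller degree than `f` — contradiction. [folklore] -/
theorem irreducible_of_degree_minimal {𝔪 : Ideal (MvPolynomial (Fin 2) K)} [h𝔪 : 𝔪.IsPrime] {f : MvPolynomial (Fin 2) K}
    (hf0 : f ≠ 0) (hf : f ∈ 𝔪)
    (hmin : ∀ a : MvPolynomial (Fin 2) K, a ∈ 𝔪 → a.totalDegree < f.totalDegree → a = 0) : Irreducible f := by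
  have hunit : ∀ {a : MvPolynomial (Fin 2) K}, a ∈ 𝔪 → ¬ IsUnit a := fun ha hu => h𝔪.ne_top (Ideal.eq_top_of_isUnit_mem 𝔪 ha hu)
  -- the key step, for a factor `a ∈ 𝔪`
  have key : ∀ a b : MvPolynomial (Fin 2) K, f = a * b → a ∈ 𝔪 → IsUnit b := by
    intro a b hab ha
    have ha0 : a ≠ 0 := by rintro rfl; exact hf0 (by rw [hab, zero_mul])
    have hb0 : b ≠ 0 := by rintro rfl; exact hf0 (by rw [hab, mul_zero])
    by_contra hb
    have hbdeg : 0 < b.totalDegree := by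
      rw [Nat.pos_iff_ne_zero]
      intro hdeg
      apply hb
      rw [isUnit_iff_totalDegree_of_isReduced]
      refine ⟨isUnit_iff_ne_zero.2 fun hc => hb0 ?_, hdeg⟩
      rw [totalDegree_eq_zero_iff_eq_C.1 hdeg, hc, C_0]
    have hfdeg : f.totalDegree = a.totalDegree + b.totalDegree := by
      rw [hab, totalDegree_mul_of_isDomain ha0 hb0]
    exact ha0 (hmin a ha (by omega))
  refine ⟨hunit hf, fun a b hab => ?_⟩
  rcases h𝔪.mem_or_mem (show a * b ∈ 𝔪 by rw [← hab]; exact hf) with ha | hb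
  · exact Or.inr (key a b hab ha)
  · exact Or.inl (key b a (by rw [hab, mul_comm]) hb)

/-! ## §5 The statement -/

/-- Arithmetic of the room inequality: with `e = δ + k` and `2q ≤ δ(e+1)`, `q + C(k+2,2) < C(e+2,2)`. [folklore] -/
theorem room_ineq {δ k q : ℕ} (hδ : 1 ≤ δ) (h2 : 2 * q ≤ δ * (δ + k + 1)) :
    q + (k + 2).choose 2 < (δ + k + 2).choose 2 := by
  have hk : 2 * (k + 2).choose 2 = (k + 2) * (k + 1) := by
    have := Nat.add_one_mul_choose_eq (k + 1) 1
    rw [Nat.choose_one_right] at this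
    -- `(k+2) * (k+1) = (k+2).choose 2 * 2`
    linarith [this]
  have he : 2 * (δ + k + 2).choose 2 = (δ + k + 2) * (δ + k + 1) := by
    have := Nat.add_one_mul_choose_eq (δ + k + 1) 1
    rw [Nat.choose_one_right] at this
    linarith [this]
  nlinarith [hk, he, h2, hδ]

/-- **CLAIM R, affine form.** For a maximal ideal `𝔪` of `K[X₀,X₁]` with residue degree `q = dim_K K[X₀,X₁]⧸𝔪`, there is `f ∈ 𝔪 ∖ 𝔪²`,
irreducible, of total degree `≤ δ` with `1 ≤ δ` and `δ(δ+1) ≤ 2q` (in fact `δ` = the least degree of a non-zero element of `𝔪` and `f` any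
element of that degree). See the module docstring for the mechanism (§1–§4 + the plane Bézout inequality of file R1).
[cite: Kunz2005PlaneAlgebraicCurves, App. A Lemma A.11] [cite: Matsumura1987, Thm. 13.5] [folklore] -/
theorem exists_mem_notMem_sq (𝔪 : Ideal (MvPolynomial (Fin 2) K)) [h𝔪 : 𝔪.IsMaximal] :
    ∃ (δ : ℕ) (f : MvPolynomial (Fin 2) K), 1 ≤ δ ∧ f ∈ 𝔪 ∧ f ∉ 𝔪 ^ 2 ∧ f ≠ 0 ∧ f.totalDegree ≤ δ ∧ Irreducible f ∧
      δ * (δ + 1) ≤ 2 * finrank K (MvPolynomial (Fin 2) K ⧸ 𝔪) := by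
  classical
  letI := Ideal.Quotient.field 𝔪
  haveI : Module.Finite K (MvPolynomial (Fin 2) K ⧸ 𝔪) := finite_of_finite_type_of_isJacobsonRing K _
  set q := finrank K (MvPolynomial (Fin 2) K ⧸ 𝔪) with hq
  -- the filtration pieces `W d = V_d ∩ 𝔪`
  let W : ℕ → Submodule K (MvPolynomial (Fin 2) K) := fun d => restrictTotalDegree (Fin 2) K d ⊓ 𝔪.restrictScalars K
  have hWmem : ∀ {d} {a : MvPolynomial (Fin 2) K}, a ∈ W d ↔ a.totalDegree ≤ d ∧ a ∈ 𝔪 := by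
    intro d a
    change a ∈ restrictTotalDegree (Fin 2) K d ⊓ 𝔪.restrictScalars K ↔ _
    rw [Submodule.mem_inf, mem_restrictTotalDegree, Submodule.restrictScalars_mem]
  have hcount : ∀ d, (d + 2).choose 2 ≤ q + finrank K ↥(W d) := by
    intro d
    have h := finrank_restrictTotalDegree_le_add 𝔪 d
    rwa [finrank_restrictTotalDegree_fin_two K d] at h
  -- `W q ≠ ⊥` (there is room in degree `q`), so a least degree `δ` with `W δ ≠ ⊥` exists
  have hex : ∃ d, W d ≠ ⊥ := by
    refine ⟨q, fun hbot => ?_⟩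
    have h := hcount q
    rw [hbot, finrank_bot, add_zero] at h
    have h2 : 2 * (q + 2).choose 2 = (q + 2) * (q + 1) := by
      have := Nat.add_one_mul_choose_eq (q + 1) 1
      rw [Nat.choose_one_right] at this
      linarith [this]
    nlinarith [h, h2]
  let δ := Nat.find hex
  have hδW : W δ ≠ ⊥ := Nat.find_spec hex
  have hδmin : ∀ d < δ, W d = ⊥ := fun d hd => not_not.1 (Nat.find_min hex hd)
  -- a non-zero `f` of degree `≤ δ` in `𝔪`; its degree is exactly `δ`, and smaller-degree elements of `𝔪` vanish
  obtain ⟨f, hfW, hf0⟩ := (Submodule.ne_bot_iff (W δ)).1 hδW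
  obtain ⟨hfdeg, hf𝔪⟩ := hWmem.1 hfW
  have hsmall : ∀ a : MvPolynomial (Fin 2) K, a ∈ 𝔪 → a.totalDegree < δ → a = 0 := by
    intro a ha hadeg
    have haW : a ∈ W a.totalDegree := hWmem.2 ⟨le_rfl, ha⟩
    rw [hδmin _ hadeg] at haW
    exact (Submodule.mem_bot K).1 haW
  have hfdeg' : f.totalDegree = δ := by
    by_contra hne
    exact hf0 (hsmall f hf𝔪 (lt_of_le_of_ne hfdeg hne))
  have hδpos : 1 ≤ δ := by
    rw [← hfdeg']; exact totalDegree_pos_of_mem h𝔪.ne_top hf0 hf𝔪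
  have hirr : Irreducible f :=
    irreducible_of_degree_minimal hf0 hf𝔪 fun a ha hadeg => hsmall a ha (by rw [← hfdeg']; exact hadeg)
  -- `δ(δ+1) ≤ 2q` from `W (δ-1) = ⊥`
  have hδq : δ * (δ + 1) ≤ 2 * q := by
    have h := hcount (δ - 1)
    rw [hδmin (δ - 1) (by omega), finrank_bot, add_zero] at h
    obtain ⟨d, hd⟩ : ∃ d, δ = d + 1 := ⟨δ - 1, by omega⟩
    rw [hd] at h ⊢
    rw [Nat.add_sub_cancel] at h
    have h2 : 2 * (d + 2).choose 2 = (d + 2) * (d + 1) := by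
      have := Nat.add_one_mul_choose_eq (d + 1) 1
      rw [Nat.choose_one_right] at this
      linarith [this]
    nlinarith [h, h2]
  refine ⟨δ, f, hδpos, hf𝔪, fun hf2 => ?_, hf0, hfdeg, hirr, hδq⟩
  -- `f ∈ 𝔪²` is absurd: the auxiliary curve `g`
  set e := (2 * q - 1) / δ with he
  have hδ0 : 0 < δ := hδpos
  have he1 : δ * e < 2 * q := by
    have h := Nat.div_mul_le_self (2 * q - 1) δ
    rw [← he] at h
    have : 1 ≤ 2 * q := by nlinarith [hδq, hδpos]
    rw [Nat.mul_comm e δ] at h; omega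
  have he2 : 2 * q ≤ δ * (e + 1) := by
    have h := Nat.lt_div_mul_add (a := 2 * q - 1) hδ0
    rw [← he, Nat.mul_comm e δ] at h
    rw [mul_add, mul_one]; omega
  have hδe : δ ≤ e := by
    by_contra hlt
    rw [not_le] at hlt
    have : δ * (e + 1) ≤ δ * δ := Nat.mul_le_mul_left δ (by omega)
    nlinarith [hδq, he2, this]
  obtain ⟨k, hk⟩ : ∃ k, e = δ + k := ⟨e - δ, by omega⟩
  have hroom : q + (e + 2 - f.totalDegree).choose 2 < (e + 2).choose 2 := by
    rw [hfdeg', hk, show δ + k + 2 - δ = k + 2 by omega]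
    exact room_ineq hδpos (by rw [hk] at he2; simpa [add_assoc] using he2)
  obtain ⟨g, hg𝔪, hgdeg, hfg⟩ := exists_mem_notMem_span_of_lt 𝔪 hf0 hroom
  have hg0 : g ≠ 0 := by rintro rfl; exact hfg (dvd_zero f)
  have hrel : IsRelPrime f g := (hirr.dvd_or_isRelPrime).resolve_left hfg
  -- upper bound (file R1) and lower bound (§1, §2) for `dim_K A⧸(f, g)`
  haveI := finite_quotient_span_pair hf0 hg0 hrel
  have hup := finrank_quotient_span_pair_le hf0 hg0 hrel
  have hup' : finrank K (MvPolynomial (Fin 2) K ⧸ Ideal.span {f, g}) < 2 * q := by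
    calc finrank K (MvPolynomial (Fin 2) K ⧸ Ideal.span {f, g}) ≤ f.totalDegree * g.totalDegree := hup
      _ ≤ δ * e := by rw [hfdeg']; exact Nat.mul_le_mul_left δ hgdeg
      _ < 2 * q := he1
  -- the ideal `J = 𝔪² + (g)` contains `(f, g)`
  set J : Ideal (MvPolynomial (Fin 2) K) := 𝔪 ^ 2 ⊔ Ideal.span {g} with hJ
  have hIJ : Ideal.span {f, g} ≤ J := by
    rw [Ideal.span_le]
    rintro x hx
    rcases hx with rfl | rfl
    · exact Ideal.mem_sup_left hf2
    · exact Ideal.mem_sup_right (Ideal.mem_span_singleton_self _)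
  have hJ𝔪 : J ≤ 𝔪 := sup_le (Ideal.pow_le_self two_ne_zero) ((Ideal.span_singleton_le_iff_mem _).2 hg𝔪)
  have hJ2 : 𝔪 * 𝔪 ≤ J := by rw [← pow_two]; exact le_sup_left
  -- height two: `𝔪 ⊄ J`
  have hheight : ¬ 𝔪.height ≤ 1 := by
    rw [Literature.AlgebraicGeometry.Resolution.MvPolynomial.height_eq_of_isMaximal K 2 𝔪]
    norm_num
  have hnot := not_le_sq_sup_span_singleton 𝔪 hheight hg𝔪
  obtain ⟨m, hm𝔪, hmJ⟩ := Set.not_subset.1 hnot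
  -- `A ⧸ J` is a quotient of `A ⧸ (f, g)`, hence finite, of dimension `≥ 2q`
  let θ : (MvPolynomial (Fin 2) K ⧸ Ideal.span {f, g}) →ₐ[K] (MvPolynomial (Fin 2) K ⧸ J) := Ideal.Quotient.factorₐ K hIJ
  have hθs : Function.Surjective θ := Ideal.Quotient.factor_surjective hIJ
  haveI : Module.Finite K (MvPolynomial (Fin 2) K ⧸ J) := Module.Finite.of_surjective θ.toLinearMap hθs
  have hlow := two_mul_finrank_le_finrank_quotient (K := K) 𝔪 J hJ𝔪 hJ2 hm𝔪 hmJ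
  have hθle : finrank K (MvPolynomial (Fin 2) K ⧸ J) ≤ finrank K (MvPolynomial (Fin 2) K ⧸ Ideal.span {f, g}) := by
    have h := LinearMap.finrank_range_le θ.toLinearMap
    rwa [LinearMap.range_eq_top.2 (fun y => hθs y), finrank_top] at h
  omega

end Summit.ResolutionOfSingularities.ResolutionOfSingularities.Theorems.SwitchingDichotomy.ClaimR
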